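import Literature.MathematicalPhysics.QuantumLattice.FreeFermionTraceFormulaProofs
import HarnessLib

/-!
# The `U(1)`-twisted free-fermion trace formula `tr (e^{cN} e^{-β dΓ(h)}) = det(1 + e^{c} e^{-βh})`

Topic `Literature/MathematicalPhysics/QuantumLattice`, companion of `FreeFermionTraceFormula(Proofs)`
(the untwisted formula `tr e^{-β dΓ(h)} = det(1 + e^{-βh})`, whose docstring leaves the twisted /
parity versions "to the prover"). All statements PROVED, no definition introduced.

* `dGamma_mul_dGamma_sub` — **`dΓ` is a Lie-algebra homomorphism**: `[dΓ(A), dΓ(B)] = dΓ([A, B])`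
  (from the tree's `[dΓ(h), c†_j]`, `[dΓ(h), c_j]`); `commute_dGamma_of_commute`;
* `dGamma_smul_one` (`dΓ(c·1) = c N`), `exp_dGamma_diagonal`
  (`e^{dΓ(diag d)} = diag (e^{Σ_{i∈s} dᵢ})`), `exp_smul_totalNumberOp_eq_diagonal`
  (`e^{cN} |s⟩ = e^{c #s} |s⟩`), `exp_pi_mul_I_smul_totalNumberOp` (`e^{iπN} = (-1)^N = parityOp`);
* `trace_exp_dGamma_unitary_conj_diagonal` — for ANY complex diagonal `d` and unitary `U`,
  `tr e^{dΓ(U diag(d) U⋆)} = det(1 + e^{U diag(d) U⋆})` (the tree's proof of the trace formula,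
  run for a normal one-body matrix given with its diagonalisation); hence
  `trace_exp_dGamma_smul_add_smul_one` — `tr e^{dΓ(a h + c 1)} = det(1 + e^{a h + c 1})` for
  Hermitian `h` and complex `a, c`;
* **the twisted trace formula** `trace_exp_smul_totalNumberOp_mul_gibbsWeight_dGamma` —
  `tr (e^{cN} e^{-β dΓ(h)}) = det(1 + e^{c·1 - βh})` for Hermitian `h`, real `β`, complex `c`
  (`c = iφ`: the `U(1)` twist of particle-number projections `P_N = (2π)⁻¹∫e^{iφ(N̂-N)}dφ`, i.e.
  an imaginary chemical potential; `c = βμ`: the grand-canonical weight);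
* **the parity-twisted trace formula** `trace_parityOp_mul_gibbsWeight_dGamma` —
  `tr ((-1)^N e^{-β dΓ(h)}) = det(1 - e^{-βh})` (the case `c = iπ`).

Sources: J. Dereziński, C. Gérard, *Mathematics of Quantization and Quantum Fields* (CUP
2013/2022), §17.2 ("Density matrix": `Tr Γ(γ) = det(𝟙 + γ)` for trace-class `γ`; here
`γ = e^{c} e^{-βh}`); O. Bratteli, D. W. Robinson, *Operator Algebras and Quantum Statistical
Mechanics 2* (1997) §5.2.1 (`dΓ`, Bogoliubov transformations), Prop. 5.2.22 ff. Folklore.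

## Mathlib / tree search

REUSED (tree): `dGamma`, `dGamma_add`, `dGamma_smul`, `dGamma_diagonal(_eq_diagonal)`,
`dGamma_commutator_creation`, `dGamma_commutator_annihilation`, `totalNumberOp`, `parityOp`,
`Matrix.gibbsWeight`, `Matrix.partitionFn`, `exists_exp_eq_coe_unitaryGroup`,
`partitionFn_dGamma_conj`, `partitionFn_dGamma_diagonal`, `det_one_add_exp_smul_conj`; Mathlib:
`Matrix.exp_add_of_commute`, `Matrix.exp_diagonal`, `Matrix.IsHermitian.spectral_theorem`,
`Complex.exp_pi_mul_I`.
-/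

noncomputable section

open NormedSpace Matrix Finset
open scoped ComplexOrder

namespace Literature.MathematicalPhysics.QuantumLattice

variable {ι : Type*} [LinearOrder ι] [Fintype ι]

/-! ### `dΓ` is a Lie-algebra homomorphism -/

/-- `[dΓ(A), c†_c c_d] = Σ_i A_{ic} c†_i c_d - Σ_i A_{di} c†_c c_i` (Leibniz rule with the tree's
`[dΓ(A), c†_c]` and `[dΓ(A), c_d]`). Bratteli–Robinson II §5.2.1. [folklore] -/
theorem dGamma_mul_creation_mul_annihilation_sub (A : Matrix ι ι ℂ) (c d : ι) :
    dGamma A * (creation c * annihilation d) - creation c * annihilation d * dGamma A =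
      ∑ i, A i c • (creation i * annihilation d) - ∑ i, A d i • (creation c * annihilation i) := by
  have h1 := dGamma_commutator_creation A c
  have h2 := dGamma_commutator_annihilation A d
  have key : dGamma A * (creation c * annihilation d) - creation c * annihilation d * dGamma A =
      (dGamma A * creation c - creation c * dGamma A) * annihilation d +
        creation c * (dGamma A * annihilation d - annihilation d * dGamma A) := by
    noncomm_ring
  rw [key, h1, h2, Finset.sum_mul, Finset.mul_sum, sub_eq_add_neg, ← Finset.sum_neg_distrib]
  congr 1
  · exact Finset.sum_congr rfl fun i _ => by rw [Matrix.smul_mul]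
  · exact Finset.sum_congr rfl fun i _ => by
      rw [Matrix.mul_smul, Matrix.neg_apply, Matrix.transpose_apply, neg_smul]

/-- `dΓ` respects differences. [folklore] -/
theorem dGamma_sub (A B : Matrix ι ι ℂ) : dGamma (A - B) = dGamma A - dGamma B := by
  simp only [dGamma_eq, Matrix.sub_apply, sub_smul, Finset.sum_sub_distrib]

/-- `dΓ(0) = 0`. [folklore] -/
theorem dGamma_zero : dGamma (0 : Matrix ι ι ℂ) = 0 := by
  simp [dGamma_eq]

/-- **`dΓ` is a Lie-algebra homomorphism**: `[dΓ(A), dΓ(B)] = dΓ(AB - BA)`.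
Bratteli–Robinson II §5.2.1. [folklore] -/
theorem dGamma_mul_dGamma_sub (A B : Matrix ι ι ℂ) :
    dGamma A * dGamma B - dGamma B * dGamma A = dGamma (A * B - B * A) := by
  have hL : dGamma A * dGamma B - dGamma B * dGamma A =
      ∑ c, ∑ d, B c d • (dGamma A * (creation c * annihilation d) -
        creation c * annihilation d * dGamma A) := by
    conv_lhs => rw [dGamma_eq B]
    simp only [Finset.mul_sum, Finset.sum_mul, Matrix.mul_smul, Matrix.smul_mul, smul_sub,
      Finset.sum_sub_distrib]
  have hT1 : ∑ c, ∑ d, B c d • ∑ i, A i c • (creation i * annihilation d) = dGamma (A * B) := by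
    simp only [Finset.smul_sum, smul_smul]
    rw [dGamma_eq]
    simp only [Matrix.mul_apply, Finset.sum_smul]
    conv_lhs => rw [Finset.sum_comm]
    conv_rhs => rw [Finset.sum_comm]
    refine Finset.sum_congr rfl fun d _ => ?_
    rw [Finset.sum_comm]
    exact Finset.sum_congr rfl fun i _ => Finset.sum_congr rfl fun c _ => by rw [mul_comm]
  have hT2 : ∑ c, ∑ d, B c d • ∑ i, A d i • (creation c * annihilation i) = dGamma (B * A) := by
    simp only [Finset.smul_sum, smul_smul]
    rw [dGamma_eq]
    simp only [Matrix.mul_apply, Finset.sum_smul]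
    exact Finset.sum_congr rfl fun c _ => Finset.sum_comm
  rw [hL]
  simp only [dGamma_mul_creation_mul_annihilation_sub, smul_sub, Finset.sum_sub_distrib]
  rw [hT1, hT2, dGamma_sub]

/-- `dΓ(A)` and `dΓ(B)` commute when `A` and `B` do (e.g. `[dΓ(h), N] = 0`). [folklore] -/
theorem commute_dGamma_of_commute {A B : Matrix ι ι ℂ} (h : Commute A B) :
    Commute (dGamma A) (dGamma B) := by
  rw [Commute, SemiconjBy, ← sub_eq_zero, dGamma_mul_dGamma_sub, h.eq, sub_self, dGamma_zero]

/-! ### The twist operators `e^{cN}` -/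

omit [Fintype ι] in
/-- `c · 1 = diag(c, …, c)` — DEPRECATED restatement of Mathlib's `smul_one_eq_diagonal`
(librarian dedup-01376, 2026-08-16). [folklore] -/
@[deprecated smul_one_eq_diagonal (since := "2026-08-16")]
theorem smul_one_eq_diagonal_const (c : ℂ) :
    c • (1 : Matrix ι ι ℂ) = diagonal fun _ => c :=
  smul_one_eq_diagonal c

/-- `dΓ(c · 1) = c N`. Bratteli–Robinson II §5.2.1. [folklore] -/
theorem dGamma_smul_one (c : ℂ) :
    dGamma (c • (1 : Matrix ι ι ℂ)) = c • (totalNumberOp : Matrix (Finset ι) (Finset ι) ℂ) := by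
  rw [smul_one_eq_diagonal, dGamma_diagonal, totalNumberOp, Finset.smul_sum]

/-- `e^{dΓ(diag d)}` is diagonal in the occupation basis with entry `e^{Σ_{i∈s} dᵢ}` on `|s⟩`.
[folklore] -/
theorem exp_dGamma_diagonal (d : ι → ℂ) :
    exp (dGamma (diagonal d)) = diagonal fun s : Finset ι => Complex.exp (∑ i ∈ s, d i) := by
  rw [dGamma_diagonal_eq_diagonal, Matrix.exp_diagonal]
  congr 1
  funext s
  rw [Pi.exp_def, Complex.exp_eq_exp_ℂ]

/-- **The `U(1)` twist is diagonal**: `e^{cN} |s⟩ = e^{c #s} |s⟩`. [folklore] -/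
theorem exp_smul_totalNumberOp_eq_diagonal (c : ℂ) :
    exp (c • (totalNumberOp : Matrix (Finset ι) (Finset ι) ℂ)) =
      diagonal fun s : Finset ι => Complex.exp (c * s.card) := by
  rw [← dGamma_smul_one, smul_one_eq_diagonal, exp_dGamma_diagonal]
  congr 1
  funext s
  rw [Finset.sum_const, nsmul_eq_mul, mul_comm]

/-- **`e^{iπN} = (-1)^N`** is the fermion parity operator `parityOp`. [folklore] -/
theorem exp_pi_mul_I_smul_totalNumberOp :
    exp (((Real.pi : ℂ) * Complex.I) • (totalNumberOp : Matrix (Finset ι) (Finset ι) ℂ)) =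
      parityOp := by
  rw [exp_smul_totalNumberOp_eq_diagonal, parityOp]
  congr 1
  funext s
  rw [show (Real.pi : ℂ) * Complex.I * (s.card : ℂ) = (s.card : ℂ) * ((Real.pi : ℂ) * Complex.I)
    by ring, Complex.exp_nat_mul, Complex.exp_pi_mul_I]

/-! ### The trace formula for a normal one-body matrix -/

/-- **`tr e^{dΓ(X)} = det(1 + e^{X})` for a unitarily diagonalised one-body matrix**
`X = U diag(d) U⋆`, `d` ANY complex diagonal: write `U = e^{K}` (`exists_exp_eq_coe_unitaryGroup`),
move to the diagonalising basis with the Bogoliubov implementer (`partitionFn_dGamma_conj`,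
`det_one_add_exp_smul_conj`) and use the one-degree-of-freedom computation
`partitionFn_dGamma_diagonal` (valid for complex `d`). Dereziński–Gérard §17.2.4 (proof of
Prop. 17.37). [cite: DerezinskiGerard2022, §17.2.4 (proof of Prop. 17.37)] -/
theorem trace_exp_dGamma_unitary_conj_diagonal (U : Matrix.unitaryGroup ι ℂ) (d : ι → ℂ) :
    (exp (dGamma ((U : Matrix ι ι ℂ) * diagonal d * star (U : Matrix ι ι ℂ)))).trace =
      (1 + exp ((U : Matrix ι ι ℂ) * diagonal d * star (U : Matrix ι ι ℂ))).det := by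
  obtain ⟨K, hK⟩ := exists_exp_eq_coe_unitaryGroup U
  have hUinv : (U : Matrix ι ι ℂ)⁻¹ = star (U : Matrix ι ι ℂ) :=
    Matrix.inv_eq_left_inv (Unitary.coe_star_mul_self U)
  have hKD : exp K * diagonal d * (exp K)⁻¹ =
      (U : Matrix ι ι ℂ) * diagonal d * star (U : Matrix ι ι ℂ) := by
    rw [hK, hUinv]
  have htr : ∀ X : Matrix (Finset ι) (Finset ι) ℂ, (exp X).trace = partitionFn (-1) X := by
    intro X
    rw [partitionFn, gibbsWeight, Complex.ofReal_neg, Complex.ofReal_one, neg_neg, one_smul]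
  have hdet : ∀ X : Matrix ι ι ℂ, (1 + exp X).det = (1 + exp (-((-1 : ℝ) : ℂ) • X)).det := by
    intro X
    rw [Complex.ofReal_neg, Complex.ofReal_one, neg_neg, one_smul]
  rw [htr, hdet, ← hKD, partitionFn_dGamma_conj, partitionFn_dGamma_diagonal]
  exact (det_one_add_exp_smul_conj _ K _).symm

/-- **`tr e^{dΓ(a h + c 1)} = det(1 + e^{a h + c 1})`** for a Hermitian one-body matrix `h` and
complex `a`, `c` (diagonalise `h = U diag(λ) U⋆`; then `a h + c 1 = U diag(aλ + c) U⋆`).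
Dereziński–Gérard §17.2 (Density matrix). [folklore] -/
theorem trace_exp_dGamma_smul_add_smul_one {h : Matrix ι ι ℂ} (hh : h.IsHermitian) (a c : ℂ) :
    (exp (dGamma (a • h + c • (1 : Matrix ι ι ℂ)))).trace =
      (1 + exp (a • h + c • (1 : Matrix ι ι ℂ))).det := by
  set U : Matrix.unitaryGroup ι ℂ := hh.eigenvectorUnitary with hU
  have hspec : h = (U : Matrix ι ι ℂ) * diagonal (RCLike.ofReal ∘ hh.eigenvalues) *
      star (U : Matrix ι ι ℂ) := by
    have := hh.spectral_theorem
    rw [Unitary.conjStarAlgAut_apply] at this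
    exact this
  have hUU : (U : Matrix ι ι ℂ) * star (U : Matrix ι ι ℂ) = 1 := Unitary.coe_mul_star_self U
  have hdiag : diagonal (fun i => a * (RCLike.ofReal ∘ hh.eigenvalues) i + c) =
      a • diagonal (RCLike.ofReal ∘ hh.eigenvalues) + c • (1 : Matrix ι ι ℂ) := by
    rw [smul_one_eq_diagonal, ← diagonal_smul, diagonal_add]
    rfl
  have hX : a • h + c • (1 : Matrix ι ι ℂ) =
      (U : Matrix ι ι ℂ) * diagonal (fun i => a * (RCLike.ofReal ∘ hh.eigenvalues) i + c) *
        star (U : Matrix ι ι ℂ) := by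
    rw [hdiag, Matrix.mul_add, Matrix.add_mul, Matrix.mul_smul, Matrix.smul_mul, ← hspec,
      Matrix.mul_smul, Matrix.smul_mul, Matrix.mul_one, hUU]
  rw [hX]
  exact trace_exp_dGamma_unitary_conj_diagonal U _

/-! ### The twisted trace formulas -/

/-- **The `U(1)`-twisted free-fermion trace formula.** For a Hermitian one-body matrix `h`, real
`β` and complex `c`: `tr (e^{cN} e^{-β dΓ(h)}) = det(1 + e^{c·1 - βh})` (`= det(1 + e^{c} e^{-βh})`).
Indeed `e^{cN} = e^{dΓ(c1)}` commutes with `e^{-βdΓ(h)}` (`[dΓ(c1), dΓ(h)] = dΓ([c1, h]) = 0`), so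
the product is `e^{dΓ(c1 - βh)}` and `trace_exp_dGamma_smul_add_smul_one` applies. With `c = iφ`
this is the twisted trace entering the particle-number projection; with `c = βμ` the
grand-canonical partition function `det(1 + e^{-β(h - μ)})`. Dereziński–Gérard §17.2 (Density
matrix: `Tr Γ(γ) = det(𝟙 + γ)`, `γ = e^{c}e^{-βh}`). [cite: DerezinskiGerard2022, §17.2 (Density matrix, display before Def. 17.36)] -/
theorem trace_exp_smul_totalNumberOp_mul_gibbsWeight_dGamma {h : Matrix ι ι ℂ}
    (hh : h.IsHermitian) (β : ℝ) (c : ℂ) :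
    (exp (c • (totalNumberOp : Matrix (Finset ι) (Finset ι) ℂ)) * gibbsWeight β (dGamma h)).trace =
      (1 + exp (c • (1 : Matrix ι ι ℂ) - (β : ℂ) • h)).det := by
  have hcomm : Commute (dGamma (c • (1 : Matrix ι ι ℂ))) (-(β : ℂ) • dGamma h) :=
    (commute_dGamma_of_commute ((Commute.one_left h).smul_left c)).smul_right _
  rw [← dGamma_smul_one, gibbsWeight, ← Matrix.exp_add_of_commute _ _ hcomm, ← dGamma_smul,
    ← dGamma_add, show c • (1 : Matrix ι ι ℂ) + -(β : ℂ) • h = (-(β : ℂ)) • h + c • 1 from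
      add_comm _ _, trace_exp_dGamma_smul_add_smul_one hh]
  congr 3
  rw [neg_smul, add_comm, sub_eq_add_neg]

/-- `e^{c·1} = e^{c} · 1` for matrices (a private copy of the tree's
`SpinOperatorsProofs.exp_smul_one_eq`, to keep the imports fermionic). [folklore] -/
private theorem exp_smul_one_eq' (c : ℂ) :
    exp (c • (1 : Matrix ι ι ℂ)) = Complex.exp c • (1 : Matrix ι ι ℂ) := by
  rw [smul_one_eq_diagonal, Matrix.exp_diagonal, smul_one_eq_diagonal]
  congr 1
  funext i
  rw [Pi.exp_def, Complex.exp_eq_exp_ℂ]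

/-- The twisted weight factorises: `e^{c·1 - βh} = e^{c} e^{-βh}`. [folklore] -/
theorem exp_smul_one_sub_smul (c : ℂ) (β : ℝ) (h : Matrix ι ι ℂ) :
    exp (c • (1 : Matrix ι ι ℂ) - (β : ℂ) • h) = Complex.exp c • exp (-(β : ℂ) • h) := by
  have hcomm : Commute (c • (1 : Matrix ι ι ℂ)) (-(β : ℂ) • h) :=
    ((Commute.one_left h).smul_left c).smul_right _
  rw [sub_eq_add_neg, ← neg_smul, Matrix.exp_add_of_commute _ _ hcomm, exp_smul_one_eq',
    Matrix.smul_mul, Matrix.one_mul]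

/-- **The twisted trace formula, product form**: `tr (e^{cN} e^{-β dΓ(h)}) = det(1 + e^{c} e^{-βh})`.
Dereziński–Gérard §17.2. [folklore] -/
theorem trace_exp_smul_totalNumberOp_mul_gibbsWeight_dGamma' {h : Matrix ι ι ℂ}
    (hh : h.IsHermitian) (β : ℝ) (c : ℂ) :
    (exp (c • (totalNumberOp : Matrix (Finset ι) (Finset ι) ℂ)) * gibbsWeight β (dGamma h)).trace =
      (1 + Complex.exp c • gibbsWeight β h).det := by
  rw [trace_exp_smul_totalNumberOp_mul_gibbsWeight_dGamma hh, exp_smul_one_sub_smul, gibbsWeight]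

/-- **The parity-twisted free-fermion trace formula**: `tr ((-1)^N e^{-β dΓ(h)}) = det(1 - e^{-βh})`
for Hermitian `h` (the case `c = iπ` of the twisted formula, `e^{iπ} = -1`). Dereziński–Gérard
§17.2 (with `Γ(-γ)`). [folklore] -/
theorem trace_parityOp_mul_gibbsWeight_dGamma {h : Matrix ι ι ℂ} (hh : h.IsHermitian) (β : ℝ) :
    ((parityOp : Matrix (Finset ι) (Finset ι) ℂ) * gibbsWeight β (dGamma h)).trace =
      (1 - gibbsWeight β h).det := by
  rw [← exp_pi_mul_I_smul_totalNumberOp, trace_exp_smul_totalNumberOp_mul_gibbsWeight_dGamma' hh,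
    Complex.exp_pi_mul_I, neg_one_smul, ← sub_eq_add_neg]

end Literature.MathematicalPhysics.QuantumLattice
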